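/-
Copyright: the b2b-balaban T⁴-continuum CRUX team, row NE7b OWNER lineage `t4-ne7b-p1` (gen 146). Project licence.
-/
import Summits.QuantumFields.BalabanUV.T4Continuum.Spine.NE7b.SupWeightedSlotTools

/-!
# TOOLS FOR THE WEIGHTED FIVE-POINT SLOT LETTERS (SCOPING-d17 §F, F13–F17: the order-5 analogue of (661)).  The weighted slot letters of
# `M₅′` ((687)) sum each of its 52 terms over FOUR free indices against the full-graph weight `W = Π_{10 pairs} ϑ`.  Typed here abstractly
# (Mathlib + (649) only): (§1) LEAF-FIRST FACTORISATIONS of fourfold sums — four single levels (`sum4_le`), two single levels followed by a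
# double level (`sum4_le_pair_last`: the `U‴`-triple summed last against its `ϑ₂`-letter), a double level followed by two single levels
# (`sum4_le_pair_first`); (§2) the two-index weighted Cauchy–Schwarz (`sum2_sqrt_mul_le_letters`, (649) §2 on `ι × ι`); (§3) the ten-factor
# monotonicity `prod10_le` (the pure `K5` term: `W ≤ Πϑ₂`); (§4) the binder permutations of a fourfold sum (each term is summed in the
# order its tree dictates) (row NE7b, node U5c; Mathlib ∕ (649) only; [folklore]).

Cell `pub-balaban`, sub-cell `t4`, spine estimate NE7b (`T4WeightBudget.RelWeightBound`; the cell's OWN estimate — NOT PRINTED in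
[Bałaban 1983–89], NOT PROVED).  Crux-route work under `Spine/NE7b/` by the row OWNER (`t4-ne7b-p1` gen 146, file (689)) under FREEZE
(0)'s crux-prover clause; NOTHING of Bałaban's is named as a Lean object, valued or asserted; no `T4Continuum/Support` leaf typed; no
`def`, no notation; zero `sorry`.  Imports (BY NAME): the OWNER's (649) `…SupWeightedSlotTools` (Mathlib through it).

WHAT IS PROVED ([folklore]): §1 **`sum4_le`**, **`sum4_le_pair_last`**, **`sum4_le_pair_first`**; §2 **`sum2_sqrt_mul_le_letters`**; §3 `prod10_le`;
§4 `sum4_perm_*` (21 binder permutations; the two rotations `2013`, `3012` are (538)'s `sum4_rot3`∕`sum4_rot4`); §5 toy.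

HONEST (what this is NOT).  Abstract inequalities only; the five weighted slot letters of `M₅′` are the next files; scalar skeleton ((A3),
NC-NE7b-α UNRULED); nothing of Bałaban's asserted.  BY-NAME EFFECT ON THE WALL: NONE.  NE7b NOT PRINTED ∕ NOT PROVED; spine PROVED 0∕9; rung
(B)+1 — the programme's measures remain FINITE-torus statements; NOT the mass gap, NOT Clay.  HONEST DEPENDENCY: continuum YM on T⁴ ⇐ BetaPertH
∧ nine spine estimates (0∕9 proved); BetaPertH ⇐ (D1) ∧ (D4) ∧ CAP+tail; G-an2-4 gates asym, D1 and NE2∕3∕4.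
-/

set_option autoImplicit false

noncomputable section

namespace Summit.QuantumFields.BalabanUV.T4Continuum.NE7b.SupWeightedFivePointTools

open Finset Real
open scoped BigOperators
open SupWeightedSlotTools (sum_sqrt_mul_le_letters)

variable {ι : Type} [Fintype ι]

/-! ## §1. Fourfold sums: leaf-first factorisations -/

/-- **FOUR SINGLE LEVELS**: `Σ_yΣ_zΣ_tΣ_s K·a_y·b_{yz}·c_{yzt}·d_{yzts} ≤ K·A·B·C·E` under row bounds at each level. [folklore] -/
theorem sum4_le {K A B C E : ℝ} {a : ι → ℝ} {b : ι → ι → ℝ} {c : ι → ι → ι → ℝ} {d : ι → ι → ι → ι → ℝ} (hK : 0 ≤ K)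
    (ha : ∀ y, 0 ≤ a y) (hb : ∀ y z, 0 ≤ b y z) (hc : ∀ y z t, 0 ≤ c y z t) (hB0 : 0 ≤ B) (hC0 : 0 ≤ C) (hE0 : 0 ≤ E)
    (hA : ∑ y, a y ≤ A) (hB : ∀ y, ∑ z, b y z ≤ B) (hC : ∀ y z, ∑ t, c y z t ≤ C) (hE : ∀ y z t, ∑ s, d y z t s ≤ E) :
    ∑ y, ∑ z, ∑ t, ∑ s, K * (a y * (b y z * (c y z t * d y z t s))) ≤ K * (A * (B * (C * E))) := by
  calc ∑ y, ∑ z, ∑ t, ∑ s, K * (a y * (b y z * (c y z t * d y z t s)))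
      _ = ∑ y, ∑ z, ∑ t, K * (a y * (b y z * (c y z t * ∑ s, d y z t s))) := by simp only [mul_sum]
      _ ≤ ∑ y, ∑ z, ∑ t, K * (a y * (b y z * (c y z t * E))) :=
          sum_le_sum fun y _ => sum_le_sum fun z _ => sum_le_sum fun t _ => mul_le_mul_of_nonneg_left (mul_le_mul_of_nonneg_left
            (mul_le_mul_of_nonneg_left (mul_le_mul_of_nonneg_left (hE y z t) (hc y z t)) (hb y z)) (ha y)) hK
      _ = ∑ y, ∑ z, K * (a y * (b y z * ((∑ t, c y z t) * E))) := by simp only [mul_sum, sum_mul]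
      _ ≤ ∑ y, ∑ z, K * (a y * (b y z * (C * E))) :=
          sum_le_sum fun y _ => sum_le_sum fun z _ => mul_le_mul_of_nonneg_left (mul_le_mul_of_nonneg_left
            (mul_le_mul_of_nonneg_left (mul_le_mul_of_nonneg_right (hC y z) hE0) (hb y z)) (ha y)) hK
      _ = ∑ y, K * (a y * ((∑ z, b y z) * (C * E))) := by simp only [mul_sum, sum_mul]
      _ ≤ ∑ y, K * (a y * (B * (C * E))) :=
          sum_le_sum fun y _ => mul_le_mul_of_nonneg_left (mul_le_mul_of_nonneg_left (mul_le_mul_of_nonneg_right (hB y)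
            (mul_nonneg hC0 hE0)) (ha y)) hK
      _ = K * ((∑ y, a y) * (B * (C * E))) := by simp only [mul_sum, sum_mul]
      _ ≤ K * (A * (B * (C * E))) := mul_le_mul_of_nonneg_left (mul_le_mul_of_nonneg_right hA (mul_nonneg hB0 (mul_nonneg hC0 hE0))) hK

/-- **TWO SINGLE LEVELS, THEN A DOUBLE LEVEL** (the `U‴`-triple summed last): `Σ_yΣ_zΣ_tΣ_s K·a_y·b_{yz}·e_{yzts} ≤ K·A·B·E` when
`Σ_tΣ_s e_{yzts} ≤ E` for every `y, z`. [folklore] -/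
theorem sum4_le_pair_last {K A B E : ℝ} {a : ι → ℝ} {b : ι → ι → ℝ} {e : ι → ι → ι → ι → ℝ} (hK : 0 ≤ K) (ha : ∀ y, 0 ≤ a y)
    (hb : ∀ y z, 0 ≤ b y z) (hB0 : 0 ≤ B) (hE0 : 0 ≤ E) (hA : ∑ y, a y ≤ A) (hB : ∀ y, ∑ z, b y z ≤ B)
    (hE : ∀ y z, ∑ t, ∑ s, e y z t s ≤ E) :
    ∑ y, ∑ z, ∑ t, ∑ s, K * (a y * (b y z * e y z t s)) ≤ K * (A * (B * E)) := by
  calc ∑ y, ∑ z, ∑ t, ∑ s, K * (a y * (b y z * e y z t s))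
      _ = ∑ y, ∑ z, K * (a y * (b y z * ∑ t, ∑ s, e y z t s)) := by simp only [mul_sum]
      _ ≤ ∑ y, ∑ z, K * (a y * (b y z * E)) :=
          sum_le_sum fun y _ => sum_le_sum fun z _ => mul_le_mul_of_nonneg_left (mul_le_mul_of_nonneg_left
            (mul_le_mul_of_nonneg_left (hE y z) (hb y z)) (ha y)) hK
      _ = ∑ y, K * (a y * ((∑ z, b y z) * E)) := by simp only [mul_sum, sum_mul]
      _ ≤ ∑ y, K * (a y * (B * E)) :=
          sum_le_sum fun y _ => mul_le_mul_of_nonneg_left (mul_le_mul_of_nonneg_left (mul_le_mul_of_nonneg_right (hB y) hE0) (ha y)) hK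
      _ = K * ((∑ y, a y) * (B * E)) := by simp only [mul_sum, sum_mul]
      _ ≤ K * (A * (B * E)) := mul_le_mul_of_nonneg_left (mul_le_mul_of_nonneg_right hA (mul_nonneg hB0 hE0)) hK

/-- **A DOUBLE LEVEL, THEN TWO SINGLE LEVELS** (the `U‴`-triple containing the fixed slot summed first, the legs hanging off it):
`Σ_yΣ_zΣ_tΣ_s K·e_{yz}·a_{yzt}·b_{yzts} ≤ K·E·A·B`. [folklore] -/
theorem sum4_le_pair_first {K E A B : ℝ} {e : ι → ι → ℝ} {a : ι → ι → ι → ℝ} {b : ι → ι → ι → ι → ℝ} (hK : 0 ≤ K)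
    (he : ∀ y z, 0 ≤ e y z) (ha : ∀ y z t, 0 ≤ a y z t) (hA0 : 0 ≤ A) (hB0 : 0 ≤ B) (hE : ∑ y, ∑ z, e y z ≤ E)
    (hA : ∀ y z, ∑ t, a y z t ≤ A) (hB : ∀ y z t, ∑ s, b y z t s ≤ B) :
    ∑ y, ∑ z, ∑ t, ∑ s, K * (e y z * (a y z t * b y z t s)) ≤ K * (E * (A * B)) := by
  calc ∑ y, ∑ z, ∑ t, ∑ s, K * (e y z * (a y z t * b y z t s))
      _ = ∑ y, ∑ z, ∑ t, K * (e y z * (a y z t * ∑ s, b y z t s)) := by simp only [mul_sum]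
      _ ≤ ∑ y, ∑ z, ∑ t, K * (e y z * (a y z t * B)) :=
          sum_le_sum fun y _ => sum_le_sum fun z _ => sum_le_sum fun t _ => mul_le_mul_of_nonneg_left (mul_le_mul_of_nonneg_left
            (mul_le_mul_of_nonneg_left (hB y z t) (ha y z t)) (he y z)) hK
      _ = ∑ y, ∑ z, K * (e y z * ((∑ t, a y z t) * B)) := by simp only [mul_sum, sum_mul]
      _ ≤ ∑ y, ∑ z, K * (e y z * (A * B)) :=
          sum_le_sum fun y _ => sum_le_sum fun z _ => mul_le_mul_of_nonneg_left (mul_le_mul_of_nonneg_left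
            (mul_le_mul_of_nonneg_right (hA y z) hB0) (he y z)) hK
      _ = K * ((∑ y, ∑ z, e y z) * (A * B)) := by simp only [mul_sum, sum_mul]
      _ ≤ K * (E * (A * B)) := mul_le_mul_of_nonneg_left (mul_le_mul_of_nonneg_right hE (mul_nonneg hA0 hB0)) hK

/-! ## §2. The two-index weighted Cauchy–Schwarz -/

/-- **TWO-INDEX WEIGHTED CAUCHY–SCHWARZ**: `Σ_bΣ_c √(a_{bc})·c_{bc} ≤ √(A·S)` when `Σ_bΣ_c θ_{bc}a_{bc} ≤ A` and `Σ_bΣ_c c_{bc}²∕θ_{bc} ≤ S`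
((649) §2 on `ι × ι`). [folklore] -/
theorem sum2_sqrt_mul_le_letters {a c θ : ι → ι → ℝ} {Aθ Sθ : ℝ} (ha : ∀ b c', 0 ≤ a b c') (hc : ∀ b c', 0 ≤ c b c')
    (hθ : ∀ b c', 0 < θ b c') (hA : ∑ b, ∑ c', θ b c' * a b c' ≤ Aθ) (hS : ∑ b, ∑ c', c b c' ^ 2 / θ b c' ≤ Sθ) :
    ∑ b, ∑ c', Real.sqrt (a b c') * c b c' ≤ Real.sqrt (Aθ * Sθ) := by
  have h := sum_sqrt_mul_le_letters (Finset.univ : Finset (ι × ι)) (a := fun p => a p.1 p.2) (c := fun p => c p.1 p.2)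
    (θ := fun p => θ p.1 p.2) (fun p => ha p.1 p.2) (fun p => hc p.1 p.2) (fun p => hθ p.1 p.2)
    (by simpa only [Fintype.sum_prod_type] using hA) (by simpa only [Fintype.sum_prod_type] using hS)
  simpa only [Fintype.sum_prod_type] using h

/-! ## §3. Ten-factor monotonicity -/

/-- **Ten-factor monotonicity** (the pure `K5` term: `W ≤ Πϑ₂`). [folklore] -/
theorem prod10_le {a₁ a₂ a₃ a₄ a₅ a₆ a₇ a₈ a₉ a₀ b₁ b₂ b₃ b₄ b₅ b₆ b₇ b₈ b₉ b₀ : ℝ} (h₁ : a₁ ≤ b₁) (h₂ : a₂ ≤ b₂) (h₃ : a₃ ≤ b₃)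
    (h₄ : a₄ ≤ b₄) (h₅ : a₅ ≤ b₅) (h₆ : a₆ ≤ b₆) (h₇ : a₇ ≤ b₇) (h₈ : a₈ ≤ b₈) (h₉ : a₉ ≤ b₉) (h₀ : a₀ ≤ b₀) (ha₁ : 0 ≤ a₁)
    (ha₂ : 0 ≤ a₂) (ha₃ : 0 ≤ a₃) (ha₄ : 0 ≤ a₄) (ha₅ : 0 ≤ a₅) (ha₆ : 0 ≤ a₆) (ha₇ : 0 ≤ a₇) (ha₈ : 0 ≤ a₈) (ha₉ : 0 ≤ a₉) (ha₀ : 0 ≤ a₀) :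
    a₁ * a₂ * a₃ * a₄ * a₅ * a₆ * a₇ * a₈ * a₉ * a₀ ≤ b₁ * b₂ * b₃ * b₄ * b₅ * b₆ * b₇ * b₈ * b₉ * b₀ := by
  have hb₁ := ha₁.trans h₁; have hb₂ := ha₂.trans h₂; have hb₃ := ha₃.trans h₃; have hb₄ := ha₄.trans h₄; have hb₅ := ha₅.trans h₅
  have hb₆ := ha₆.trans h₆; have hb₇ := ha₇.trans h₇; have hb₈ := ha₈.trans h₈; have hb₉ := ha₉.trans h₉
  exact (mul_le_mul (mul_le_mul (mul_le_mul (mul_le_mul (mul_le_mul (mul_le_mul (mul_le_mul (mul_le_mul (mul_le_mul h₁ h₂ ha₂ hb₁) h₃ ha₃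
        (mul_nonneg hb₁ hb₂)) h₄ ha₄ (mul_nonneg (mul_nonneg hb₁ hb₂) hb₃)) h₅ ha₅ (mul_nonneg (mul_nonneg (mul_nonneg hb₁ hb₂) hb₃) hb₄)) h₆ ha₆
        (mul_nonneg (mul_nonneg (mul_nonneg (mul_nonneg hb₁ hb₂) hb₃) hb₄) hb₅)) h₇ ha₇ (mul_nonneg (mul_nonneg (mul_nonneg (mul_nonneg (mul_nonneg
        hb₁ hb₂) hb₃) hb₄) hb₅) hb₆)) h₈ ha₈ (mul_nonneg (mul_nonneg (mul_nonneg (mul_nonneg (mul_nonneg (mul_nonneg hb₁ hb₂) hb₃) hb₄) hb₅) hb₆)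
        hb₇)) h₉ ha₉ (mul_nonneg (mul_nonneg (mul_nonneg (mul_nonneg (mul_nonneg (mul_nonneg (mul_nonneg hb₁ hb₂) hb₃) hb₄) hb₅) hb₆) hb₇) hb₈)) h₀
        ha₀ (mul_nonneg (mul_nonneg (mul_nonneg (mul_nonneg (mul_nonneg (mul_nonneg (mul_nonneg (mul_nonneg hb₁ hb₂) hb₃) hb₄) hb₅) hb₆) hb₇) hb₈)
        hb₉))

/-! ## §4. Binder permutations of fourfold sums -/

/-- Binder permutation `0132` of a fourfold sum. [folklore] -/
theorem sum4_perm_0132 (f : ι → ι → ι → ι → ℝ) :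
    ∑ a, ∑ b, ∑ c, ∑ d, f a b c d = ∑ a, ∑ b, ∑ d, ∑ c, f a b c d := by
  calc ∑ a, ∑ b, ∑ c, ∑ d, f a b c d
      _ = ∑ a, ∑ b, ∑ d, ∑ c, f a b c d := Finset.sum_congr rfl (fun _ _ => Finset.sum_congr rfl (fun _ _ => Finset.sum_comm))

/-- Binder permutation `0213` of a fourfold sum. [folklore] -/
theorem sum4_perm_0213 (f : ι → ι → ι → ι → ℝ) :
    ∑ a, ∑ b, ∑ c, ∑ d, f a b c d = ∑ a, ∑ c, ∑ b, ∑ d, f a b c d := by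
  calc ∑ a, ∑ b, ∑ c, ∑ d, f a b c d
      _ = ∑ a, ∑ c, ∑ b, ∑ d, f a b c d := Finset.sum_congr rfl (fun _ _ => Finset.sum_comm)

/-- Binder permutation `0231` of a fourfold sum. [folklore] -/
theorem sum4_perm_0231 (f : ι → ι → ι → ι → ℝ) :
    ∑ a, ∑ b, ∑ c, ∑ d, f a b c d = ∑ a, ∑ c, ∑ d, ∑ b, f a b c d := by
  calc ∑ a, ∑ b, ∑ c, ∑ d, f a b c d
      _ = ∑ a, ∑ c, ∑ b, ∑ d, f a b c d := Finset.sum_congr rfl (fun _ _ => Finset.sum_comm)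
      _ = ∑ a, ∑ c, ∑ d, ∑ b, f a b c d := Finset.sum_congr rfl (fun _ _ => Finset.sum_congr rfl (fun _ _ => Finset.sum_comm))

/-- Binder permutation `0312` of a fourfold sum. [folklore] -/
theorem sum4_perm_0312 (f : ι → ι → ι → ι → ℝ) :
    ∑ a, ∑ b, ∑ c, ∑ d, f a b c d = ∑ a, ∑ d, ∑ b, ∑ c, f a b c d := by
  calc ∑ a, ∑ b, ∑ c, ∑ d, f a b c d
      _ = ∑ a, ∑ b, ∑ d, ∑ c, f a b c d := Finset.sum_congr rfl (fun _ _ => Finset.sum_congr rfl (fun _ _ => Finset.sum_comm))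
      _ = ∑ a, ∑ d, ∑ b, ∑ c, f a b c d := Finset.sum_congr rfl (fun _ _ => Finset.sum_comm)

/-- Binder permutation `0321` of a fourfold sum. [folklore] -/
theorem sum4_perm_0321 (f : ι → ι → ι → ι → ℝ) :
    ∑ a, ∑ b, ∑ c, ∑ d, f a b c d = ∑ a, ∑ d, ∑ c, ∑ b, f a b c d := by
  calc ∑ a, ∑ b, ∑ c, ∑ d, f a b c d
      _ = ∑ a, ∑ b, ∑ d, ∑ c, f a b c d := Finset.sum_congr rfl (fun _ _ => Finset.sum_congr rfl (fun _ _ => Finset.sum_comm))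
      _ = ∑ a, ∑ d, ∑ b, ∑ c, f a b c d := Finset.sum_congr rfl (fun _ _ => Finset.sum_comm)
      _ = ∑ a, ∑ d, ∑ c, ∑ b, f a b c d := Finset.sum_congr rfl (fun _ _ => Finset.sum_congr rfl (fun _ _ => Finset.sum_comm))

/-- Binder permutation `1023` of a fourfold sum. [folklore] -/
theorem sum4_perm_1023 (f : ι → ι → ι → ι → ℝ) :
    ∑ a, ∑ b, ∑ c, ∑ d, f a b c d = ∑ b, ∑ a, ∑ c, ∑ d, f a b c d := by
  calc ∑ a, ∑ b, ∑ c, ∑ d, f a b c d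
      _ = ∑ b, ∑ a, ∑ c, ∑ d, f a b c d := Finset.sum_comm

/-- Binder permutation `1032` of a fourfold sum. [folklore] -/
theorem sum4_perm_1032 (f : ι → ι → ι → ι → ℝ) :
    ∑ a, ∑ b, ∑ c, ∑ d, f a b c d = ∑ b, ∑ a, ∑ d, ∑ c, f a b c d := by
  calc ∑ a, ∑ b, ∑ c, ∑ d, f a b c d
      _ = ∑ b, ∑ a, ∑ c, ∑ d, f a b c d := Finset.sum_comm
      _ = ∑ b, ∑ a, ∑ d, ∑ c, f a b c d := Finset.sum_congr rfl (fun _ _ => Finset.sum_congr rfl (fun _ _ => Finset.sum_comm))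

/-- Binder permutation `1203` of a fourfold sum. [folklore] -/
theorem sum4_perm_1203 (f : ι → ι → ι → ι → ℝ) :
    ∑ a, ∑ b, ∑ c, ∑ d, f a b c d = ∑ b, ∑ c, ∑ a, ∑ d, f a b c d := by
  calc ∑ a, ∑ b, ∑ c, ∑ d, f a b c d
      _ = ∑ b, ∑ a, ∑ c, ∑ d, f a b c d := Finset.sum_comm
      _ = ∑ b, ∑ c, ∑ a, ∑ d, f a b c d := Finset.sum_congr rfl (fun _ _ => Finset.sum_comm)

/-- Binder permutation `1230` of a fourfold sum. [folklore] -/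
theorem sum4_perm_1230 (f : ι → ι → ι → ι → ℝ) :
    ∑ a, ∑ b, ∑ c, ∑ d, f a b c d = ∑ b, ∑ c, ∑ d, ∑ a, f a b c d := by
  calc ∑ a, ∑ b, ∑ c, ∑ d, f a b c d
      _ = ∑ b, ∑ a, ∑ c, ∑ d, f a b c d := Finset.sum_comm
      _ = ∑ b, ∑ c, ∑ a, ∑ d, f a b c d := Finset.sum_congr rfl (fun _ _ => Finset.sum_comm)
      _ = ∑ b, ∑ c, ∑ d, ∑ a, f a b c d := Finset.sum_congr rfl (fun _ _ => Finset.sum_congr rfl (fun _ _ => Finset.sum_comm))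

/-- Binder permutation `1302` of a fourfold sum. [folklore] -/
theorem sum4_perm_1302 (f : ι → ι → ι → ι → ℝ) :
    ∑ a, ∑ b, ∑ c, ∑ d, f a b c d = ∑ b, ∑ d, ∑ a, ∑ c, f a b c d := by
  calc ∑ a, ∑ b, ∑ c, ∑ d, f a b c d
      _ = ∑ b, ∑ a, ∑ c, ∑ d, f a b c d := Finset.sum_comm
      _ = ∑ b, ∑ a, ∑ d, ∑ c, f a b c d := Finset.sum_congr rfl (fun _ _ => Finset.sum_congr rfl (fun _ _ => Finset.sum_comm))
      _ = ∑ b, ∑ d, ∑ a, ∑ c, f a b c d := Finset.sum_congr rfl (fun _ _ => Finset.sum_comm)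

/-- Binder permutation `1320` of a fourfold sum. [folklore] -/
theorem sum4_perm_1320 (f : ι → ι → ι → ι → ℝ) :
    ∑ a, ∑ b, ∑ c, ∑ d, f a b c d = ∑ b, ∑ d, ∑ c, ∑ a, f a b c d := by
  calc ∑ a, ∑ b, ∑ c, ∑ d, f a b c d
      _ = ∑ b, ∑ a, ∑ c, ∑ d, f a b c d := Finset.sum_comm
      _ = ∑ b, ∑ a, ∑ d, ∑ c, f a b c d := Finset.sum_congr rfl (fun _ _ => Finset.sum_congr rfl (fun _ _ => Finset.sum_comm))
      _ = ∑ b, ∑ d, ∑ a, ∑ c, f a b c d := Finset.sum_congr rfl (fun _ _ => Finset.sum_comm)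
      _ = ∑ b, ∑ d, ∑ c, ∑ a, f a b c d := Finset.sum_congr rfl (fun _ _ => Finset.sum_congr rfl (fun _ _ => Finset.sum_comm))

/-- Binder permutation `2031` of a fourfold sum. [folklore] -/
theorem sum4_perm_2031 (f : ι → ι → ι → ι → ℝ) :
    ∑ a, ∑ b, ∑ c, ∑ d, f a b c d = ∑ c, ∑ a, ∑ d, ∑ b, f a b c d := by
  calc ∑ a, ∑ b, ∑ c, ∑ d, f a b c d
      _ = ∑ a, ∑ c, ∑ b, ∑ d, f a b c d := Finset.sum_congr rfl (fun _ _ => Finset.sum_comm)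
      _ = ∑ c, ∑ a, ∑ b, ∑ d, f a b c d := Finset.sum_comm
      _ = ∑ c, ∑ a, ∑ d, ∑ b, f a b c d := Finset.sum_congr rfl (fun _ _ => Finset.sum_congr rfl (fun _ _ => Finset.sum_comm))

/-- Binder permutation `2103` of a fourfold sum. [folklore] -/
theorem sum4_perm_2103 (f : ι → ι → ι → ι → ℝ) :
    ∑ a, ∑ b, ∑ c, ∑ d, f a b c d = ∑ c, ∑ b, ∑ a, ∑ d, f a b c d := by
  calc ∑ a, ∑ b, ∑ c, ∑ d, f a b c d
      _ = ∑ a, ∑ c, ∑ b, ∑ d, f a b c d := Finset.sum_congr rfl (fun _ _ => Finset.sum_comm)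
      _ = ∑ c, ∑ a, ∑ b, ∑ d, f a b c d := Finset.sum_comm
      _ = ∑ c, ∑ b, ∑ a, ∑ d, f a b c d := Finset.sum_congr rfl (fun _ _ => Finset.sum_comm)

/-- Binder permutation `2130` of a fourfold sum. [folklore] -/
theorem sum4_perm_2130 (f : ι → ι → ι → ι → ℝ) :
    ∑ a, ∑ b, ∑ c, ∑ d, f a b c d = ∑ c, ∑ b, ∑ d, ∑ a, f a b c d := by
  calc ∑ a, ∑ b, ∑ c, ∑ d, f a b c d
      _ = ∑ a, ∑ c, ∑ b, ∑ d, f a b c d := Finset.sum_congr rfl (fun _ _ => Finset.sum_comm)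
      _ = ∑ c, ∑ a, ∑ b, ∑ d, f a b c d := Finset.sum_comm
      _ = ∑ c, ∑ b, ∑ a, ∑ d, f a b c d := Finset.sum_congr rfl (fun _ _ => Finset.sum_comm)
      _ = ∑ c, ∑ b, ∑ d, ∑ a, f a b c d := Finset.sum_congr rfl (fun _ _ => Finset.sum_congr rfl (fun _ _ => Finset.sum_comm))

/-- Binder permutation `2301` of a fourfold sum. [folklore] -/
theorem sum4_perm_2301 (f : ι → ι → ι → ι → ℝ) :
    ∑ a, ∑ b, ∑ c, ∑ d, f a b c d = ∑ c, ∑ d, ∑ a, ∑ b, f a b c d := by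
  calc ∑ a, ∑ b, ∑ c, ∑ d, f a b c d
      _ = ∑ a, ∑ c, ∑ b, ∑ d, f a b c d := Finset.sum_congr rfl (fun _ _ => Finset.sum_comm)
      _ = ∑ c, ∑ a, ∑ b, ∑ d, f a b c d := Finset.sum_comm
      _ = ∑ c, ∑ a, ∑ d, ∑ b, f a b c d := Finset.sum_congr rfl (fun _ _ => Finset.sum_congr rfl (fun _ _ => Finset.sum_comm))
      _ = ∑ c, ∑ d, ∑ a, ∑ b, f a b c d := Finset.sum_congr rfl (fun _ _ => Finset.sum_comm)

/-- Binder permutation `2310` of a fourfold sum. [folklore] -/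
theorem sum4_perm_2310 (f : ι → ι → ι → ι → ℝ) :
    ∑ a, ∑ b, ∑ c, ∑ d, f a b c d = ∑ c, ∑ d, ∑ b, ∑ a, f a b c d := by
  calc ∑ a, ∑ b, ∑ c, ∑ d, f a b c d
      _ = ∑ a, ∑ c, ∑ b, ∑ d, f a b c d := Finset.sum_congr rfl (fun _ _ => Finset.sum_comm)
      _ = ∑ c, ∑ a, ∑ b, ∑ d, f a b c d := Finset.sum_comm
      _ = ∑ c, ∑ a, ∑ d, ∑ b, f a b c d := Finset.sum_congr rfl (fun _ _ => Finset.sum_congr rfl (fun _ _ => Finset.sum_comm))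
      _ = ∑ c, ∑ d, ∑ a, ∑ b, f a b c d := Finset.sum_congr rfl (fun _ _ => Finset.sum_comm)
      _ = ∑ c, ∑ d, ∑ b, ∑ a, f a b c d := Finset.sum_congr rfl (fun _ _ => Finset.sum_congr rfl (fun _ _ => Finset.sum_comm))

/-- Binder permutation `3021` of a fourfold sum. [folklore] -/
theorem sum4_perm_3021 (f : ι → ι → ι → ι → ℝ) :
    ∑ a, ∑ b, ∑ c, ∑ d, f a b c d = ∑ d, ∑ a, ∑ c, ∑ b, f a b c d := by
  calc ∑ a, ∑ b, ∑ c, ∑ d, f a b c d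
      _ = ∑ a, ∑ b, ∑ d, ∑ c, f a b c d := Finset.sum_congr rfl (fun _ _ => Finset.sum_congr rfl (fun _ _ => Finset.sum_comm))
      _ = ∑ a, ∑ d, ∑ b, ∑ c, f a b c d := Finset.sum_congr rfl (fun _ _ => Finset.sum_comm)
      _ = ∑ d, ∑ a, ∑ b, ∑ c, f a b c d := Finset.sum_comm
      _ = ∑ d, ∑ a, ∑ c, ∑ b, f a b c d := Finset.sum_congr rfl (fun _ _ => Finset.sum_congr rfl (fun _ _ => Finset.sum_comm))

/-- Binder permutation `3102` of a fourfold sum. [folklore] -/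
theorem sum4_perm_3102 (f : ι → ι → ι → ι → ℝ) :
    ∑ a, ∑ b, ∑ c, ∑ d, f a b c d = ∑ d, ∑ b, ∑ a, ∑ c, f a b c d := by
  calc ∑ a, ∑ b, ∑ c, ∑ d, f a b c d
      _ = ∑ a, ∑ b, ∑ d, ∑ c, f a b c d := Finset.sum_congr rfl (fun _ _ => Finset.sum_congr rfl (fun _ _ => Finset.sum_comm))
      _ = ∑ a, ∑ d, ∑ b, ∑ c, f a b c d := Finset.sum_congr rfl (fun _ _ => Finset.sum_comm)
      _ = ∑ d, ∑ a, ∑ b, ∑ c, f a b c d := Finset.sum_comm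
      _ = ∑ d, ∑ b, ∑ a, ∑ c, f a b c d := Finset.sum_congr rfl (fun _ _ => Finset.sum_comm)

/-- Binder permutation `3120` of a fourfold sum. [folklore] -/
theorem sum4_perm_3120 (f : ι → ι → ι → ι → ℝ) :
    ∑ a, ∑ b, ∑ c, ∑ d, f a b c d = ∑ d, ∑ b, ∑ c, ∑ a, f a b c d := by
  calc ∑ a, ∑ b, ∑ c, ∑ d, f a b c d
      _ = ∑ a, ∑ b, ∑ d, ∑ c, f a b c d := Finset.sum_congr rfl (fun _ _ => Finset.sum_congr rfl (fun _ _ => Finset.sum_comm))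
      _ = ∑ a, ∑ d, ∑ b, ∑ c, f a b c d := Finset.sum_congr rfl (fun _ _ => Finset.sum_comm)
      _ = ∑ d, ∑ a, ∑ b, ∑ c, f a b c d := Finset.sum_comm
      _ = ∑ d, ∑ b, ∑ a, ∑ c, f a b c d := Finset.sum_congr rfl (fun _ _ => Finset.sum_comm)
      _ = ∑ d, ∑ b, ∑ c, ∑ a, f a b c d := Finset.sum_congr rfl (fun _ _ => Finset.sum_congr rfl (fun _ _ => Finset.sum_comm))

/-- Binder permutation `3201` of a fourfold sum. [folklore] -/
theorem sum4_perm_3201 (f : ι → ι → ι → ι → ℝ) :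
    ∑ a, ∑ b, ∑ c, ∑ d, f a b c d = ∑ d, ∑ c, ∑ a, ∑ b, f a b c d := by
  calc ∑ a, ∑ b, ∑ c, ∑ d, f a b c d
      _ = ∑ a, ∑ b, ∑ d, ∑ c, f a b c d := Finset.sum_congr rfl (fun _ _ => Finset.sum_congr rfl (fun _ _ => Finset.sum_comm))
      _ = ∑ a, ∑ d, ∑ b, ∑ c, f a b c d := Finset.sum_congr rfl (fun _ _ => Finset.sum_comm)
      _ = ∑ d, ∑ a, ∑ b, ∑ c, f a b c d := Finset.sum_comm
      _ = ∑ d, ∑ a, ∑ c, ∑ b, f a b c d := Finset.sum_congr rfl (fun _ _ => Finset.sum_congr rfl (fun _ _ => Finset.sum_comm))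
      _ = ∑ d, ∑ c, ∑ a, ∑ b, f a b c d := Finset.sum_congr rfl (fun _ _ => Finset.sum_comm)

/-- Binder permutation `3210` of a fourfold sum. [folklore] -/
theorem sum4_perm_3210 (f : ι → ι → ι → ι → ℝ) :
    ∑ a, ∑ b, ∑ c, ∑ d, f a b c d = ∑ d, ∑ c, ∑ b, ∑ a, f a b c d := by
  calc ∑ a, ∑ b, ∑ c, ∑ d, f a b c d
      _ = ∑ a, ∑ b, ∑ d, ∑ c, f a b c d := Finset.sum_congr rfl (fun _ _ => Finset.sum_congr rfl (fun _ _ => Finset.sum_comm))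
      _ = ∑ a, ∑ d, ∑ b, ∑ c, f a b c d := Finset.sum_congr rfl (fun _ _ => Finset.sum_comm)
      _ = ∑ d, ∑ a, ∑ b, ∑ c, f a b c d := Finset.sum_comm
      _ = ∑ d, ∑ a, ∑ c, ∑ b, f a b c d := Finset.sum_congr rfl (fun _ _ => Finset.sum_congr rfl (fun _ _ => Finset.sum_comm))
      _ = ∑ d, ∑ c, ∑ a, ∑ b, f a b c d := Finset.sum_congr rfl (fun _ _ => Finset.sum_comm)
      _ = ∑ d, ∑ c, ∑ b, ∑ a, f a b c d := Finset.sum_congr rfl (fun _ _ => Finset.sum_congr rfl (fun _ _ => Finset.sum_comm))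

/-! ## §5. Toy -/

/-- Toy (the two-index Cauchy–Schwarz in numbers, one point): `√a·c ≤ √(θa·(c²∕θ))` with `a = 4`, `c = 3`, `θ = 1`: `2·3 ≤ √(4·9) = 6`. -/
example : Real.sqrt 4 * 3 ≤ Real.sqrt (4 * 9) := by
  rw [show (4 : ℝ) * 9 = 6 ^ 2 by norm_num, Real.sqrt_sq (by norm_num), show (4 : ℝ) = 2 ^ 2 by norm_num, Real.sqrt_sq (by norm_num)]
  norm_num

end Summit.QuantumFields.BalabanUV.T4Continuum.NE7b.SupWeightedFivePointTools

end
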